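import Summits.Ventures.Crystal3D.Theorems.StickyWulffConstantCoaxialWallLawChainHexagonRigidity
import Summits.Ventures.Crystal3D.Theorems.StickyWulffConstantCoaxialWallLawTerracePropagation
import Summits.Ventures.Crystal3D.Theorems.StickyWulffConstantCoaxialWallLawFluxGap
import Summits.Ventures.Crystal3D.Theorems.StickyWulffConstantCoaxialWallLawTwinFrames
import Summits.Ventures.Crystal3D.Theorems.StickyWulffConstantGenericWallFloorSealing
import HarnessLib

/-!
# AXIS RIGIDITY of twin chains: a Σ3ⁿ-relative of `Λ₀` sharing the threefold axis `e₃` is `Λ₀` or its basal twin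

HONEST FRAMING. Venture `Summits/Ventures/Crystal3D` (cell `crystal3d-full`); helper `--supports` the crux `CoaxialWallLaw` (stmt-Ventures-19481):
census-free lattice algebra — fact (F2) of HOME/wall-19481-p1/g17/FAMOFF-SIZING-g17.md (lane T `stub_famOffFamily`: the «same axis, twisted» pairs have no corner
coincidence), step (R-b) of BOTHFAULTED-LINE-g17.md («the far face of a crossed lamella is parallel»), and the junction exclusion of the reader-local form of
`TailResidue.LocalBarlowRigidity`.  Nothing about the crux is claimed; F-C1 not moved.

* `normForm_eq_three` — the six integer solutions of `I² + IJ + J² = 3`, each as `(3m + r, 3n + r)` with `r ∈ {1, 2}`;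
* `exists_coords_of_inplane_slot` — an in-plane slot is `barlowPos 0 i j`;
* **`image_fccSlots_eq_or_mirror_of_axis`** — DOZEN DICHOTOMY: for a linear isometry `G` with `e₃` a menu normal and every in-plane `G w` a slot of `Λ₀`
  (the output of `wordFrame_inplane_mem_fccSlots`), the slot dozen of `G` is the dozen of `Λ₀` or its basal mirror image: `fccSlots.image G = fccSlots` or
  `fccSlots.image (R_{e₃} ∘ G) = fccSlots`.  Proof: the far triple `a, b, c` of `e₃` (`exists_far_frame`) has `3·G a = √6 e₃ + G(a−b) + G(a−c)` with the two
  in-plane slots at `60°`, so `G(a−b) + G(a−c) = barlowPos 0 I J` with `I² + IJ + J² = 3`; the residue `r` puts `G a` on layer `+1` of `Λ₀` (`r = 1`) or its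
  mirror on layer `−1` (`r = 2`); the rest of the dozen follows by lattice translations;
* **`wordFrame_axis_rigidity`** — for a REDUCED chain `κ` of unit model menu normals (`⟪μ, μ'⟫ = ±1/3` consecutively), if `e₃` is a menu normal of
  `wordFrame 1 κ` then `κ = []` or `κ = [e₃]` or `κ = [−e₃]` (hexagon rigidity + dozen dichotomy + `map_reflection_eq_of_image_eq`);
  `wordFrame_axis_rigidity_base` — the same over any base frame `B` with axis `B e₃`.
-/

noncomputable section

namespace Summit.Ventures.Crystal3D.Theorems

open Summit.Ventures.Crystal3D Finset
open Literature.MathematicalPhysics.StatisticalMechanics (barlowPos fccStacking constHagg barlowPos_apply_zero barlowPos_apply_one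
  barlowPos_apply_two barlowPos_mem mem_barlowStacking_iff haggLabel_const)
open scoped InnerProductSpace

/-- The six integer solutions of `I² + IJ + J² = 3`, by residue: `(I, J) = (3m + r, 3n + r)` with `r = 1` or `r = 2` (witnesses `m = I/3`, `n = J/3`, `r = I % 3`). -/
theorem normForm_eq_three {I J : ℤ} (h : I ^ 2 + I * J + J ^ 2 = 3) :
    ∃ m n r : ℤ, (r = 1 ∨ r = 2) ∧ I = 3 * m + r ∧ J = 3 * n + r := by
  have hJ : J ^ 2 ≤ 4 := by nlinarith [sq_nonneg (2 * I + J)]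
  have hI : I ^ 2 ≤ 4 := by nlinarith [sq_nonneg (2 * J + I)]
  have hJ' : -2 ≤ J ∧ J ≤ 2 := by constructor <;> nlinarith
  have hI' : -2 ≤ I ∧ I ≤ 2 := by constructor <;> nlinarith
  obtain ⟨hI1, hI2⟩ := hI'
  obtain ⟨hJ1, hJ2⟩ := hJ'
  refine ⟨I / 3, J / 3, I % 3, ?_⟩
  interval_cases I <;> interval_cases J <;> first | (exfalso; norm_num at h; done) | norm_num

/-- An in-plane slot is a site of layer `0`: `w = barlowPos 0 i j`. -/
theorem exists_coords_of_inplane_slot {w : EuclideanSpace ℝ (Fin 3)} (hw : w ∈ fccSlots) (h2 : w 2 = 0) :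
    ∃ i j : ℤ, w = barlowPos 1 (Real.sqrt (2 / 3)) constHagg 0 i j := by
  obtain ⟨k, i, j, hp⟩ := mem_barlowStacking_iff.1 (mem_fcc_of_mem_fccSlots hw)
  have hk : k = 0 := by
    have h := congrArg (fun v : EuclideanSpace ℝ (Fin 3) => v 2) hp
    simp only [h2, barlowPos_apply_two] at h
    have hs : Real.sqrt (2 / 3) ≠ 0 := Real.sqrt_ne_zero'.2 (by norm_num)
    rcases mul_eq_zero.1 h.symm with h' | h'
    · exact_mod_cast h'
    · exact absurd h' hs
  subst hk
  exact ⟨i, j, hp⟩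

/-- `√6 / 3 = √(2/3)`. -/
theorem sqrt_six_div_three : Real.sqrt 6 / 3 = Real.sqrt (2 / 3) := by
  rw [show (2 / 3 : ℝ) = 6 / 9 by norm_num, Real.sqrt_div (by norm_num : (0:ℝ) ≤ 6),
    show (9 : ℝ) = 3 ^ 2 by norm_num, Real.sqrt_sq (by norm_num : (0:ℝ) ≤ 3)]

/-- Coordinates of `e₃`. -/
theorem e₃_apply : (EuclideanSpace.single (2 : Fin 3) (1 : ℝ)) 0 = 0 ∧ (EuclideanSpace.single (2 : Fin 3) (1 : ℝ)) 1 = 0 ∧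
    (EuclideanSpace.single (2 : Fin 3) (1 : ℝ)) 2 = 1 := by
  refine ⟨?_, ?_, ?_⟩ <;> simp

/-- Coordinates of `√6 e₃ + barlowPos 0 I J`. -/
theorem coords_sqrt6_e₃_add_barlowPos (I J : ℤ) :
    (Real.sqrt 6 • EuclideanSpace.single (2 : Fin 3) (1 : ℝ) + barlowPos 1 (Real.sqrt (2 / 3)) constHagg 0 I J) 0 = I + J / 2 ∧
    (Real.sqrt 6 • EuclideanSpace.single (2 : Fin 3) (1 : ℝ) + barlowPos 1 (Real.sqrt (2 / 3)) constHagg 0 I J) 1 =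
      Real.sqrt 3 / 2 * J ∧
    (Real.sqrt 6 • EuclideanSpace.single (2 : Fin 3) (1 : ℝ) + barlowPos 1 (Real.sqrt (2 / 3)) constHagg 0 I J) 2 = Real.sqrt 6 := by
  obtain ⟨e0, e1, e2⟩ := e₃_apply
  refine ⟨?_, ?_, ?_⟩
  · rw [PiLp.add_apply, PiLp.smul_apply, smul_eq_mul, e0, barlowPos_apply_zero, haggLabel_const]; push_cast; ring
  · rw [PiLp.add_apply, PiLp.smul_apply, smul_eq_mul, e1, barlowPos_apply_one, haggLabel_const]; push_cast; ring
  · rw [PiLp.add_apply, PiLp.smul_apply, smul_eq_mul, e2, barlowPos_apply_two]; push_cast; ring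

section Dichotomy

variable {G : EuclideanSpace ℝ (Fin 3) ≃ₗᵢ[ℝ] EuclideanSpace ℝ (Fin 3)}

/-- **DOZEN DICHOTOMY.**  If `e₃` is a menu normal of the isometry `G` and every in-plane `G w` (`w` a slot) is a slot of `Λ₀`, then the slot dozen of `G`
is the dozen of `Λ₀` or its basal mirror image. -/
theorem image_fccSlots_eq_or_mirror_of_axis
    (hmenu : ∀ w ∈ fccSlots, ⟪G w, EuclideanSpace.single (2 : Fin 3) (1 : ℝ)⟫_ℝ = 0 ∨
      ⟪G w, EuclideanSpace.single (2 : Fin 3) (1 : ℝ)⟫_ℝ = Real.sqrt (2 / 3) ∨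
      ⟪G w, EuclideanSpace.single (2 : Fin 3) (1 : ℝ)⟫_ℝ = -Real.sqrt (2 / 3))
    (hin : ∀ w ∈ fccSlots, ⟪G w, EuclideanSpace.single (2 : Fin 3) (1 : ℝ)⟫_ℝ = 0 → G w ∈ fccSlots) :
    fccSlots.image (fun w => G w) = fccSlots ∨
      fccSlots.image (fun w => (ℝ ∙ EuclideanSpace.single (2 : Fin 3) (1 : ℝ))ᗮ.reflection (G w)) = fccSlots := by
  classical
  set e₃ : EuclideanSpace ℝ (Fin 3) := EuclideanSpace.single (2 : Fin 3) (1 : ℝ) with he₃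
  set R := (ℝ ∙ e₃)ᗮ.reflection with hR
  have hn : ‖e₃‖ = 1 := by rw [he₃, PiLp.norm_single, norm_one]
  have hrpos : 0 < Real.sqrt (2 / 3) := Real.sqrt_pos.2 (by norm_num)
  obtain ⟨a, ha, b, hb, c, hc, hna, hnb, hnc, iab, iac, ibc, -, huniq⟩ := exists_far_frame G hn hmenu
  -- the far face sums to √6 e₃
  have hsum : G a + G b + G c = Real.sqrt 6 • e₃ := by
    have key : ∀ z, ⟪G a + G b + G c - Real.sqrt 6 • e₃, z⟫_ℝ = 0 := by
      intro z
      have h := sum_far_inner (A := G) hn ha hb hc hna hnb hnc iab iac ibc z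
      rw [inner_sub_left, inner_add_left, inner_add_left, real_inner_smul_left, h]; ring
    have h0 : G a + G b + G c - Real.sqrt 6 • e₃ = 0 := by
      rw [← inner_self_eq_zero (𝕜 := ℝ)]; exact key _
    exact sub_eq_zero.1 h0
  -- the two in-plane differences
  have hd₁s : a - b ∈ fccSlots := sub_mem_fccSlots_of_inner_eq_half ha hb iab
  have hd₂s : a - c ∈ fccSlots := sub_mem_fccSlots_of_inner_eq_half ha hc iac
  have hd₁0 : ⟪G (a - b), e₃⟫_ℝ = 0 := by rw [map_sub, inner_sub_left, hna, hnb, sub_self]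
  have hd₂0 : ⟪G (a - c), e₃⟫_ℝ = 0 := by rw [map_sub, inner_sub_left, hna, hnc, sub_self]
  have hd₁ : G (a - b) ∈ fccSlots := hin _ hd₁s hd₁0
  have hd₂ : G (a - c) ∈ fccSlots := hin _ hd₂s hd₂0
  obtain ⟨i₁, j₁, hij₁⟩ := exists_coords_of_inplane_slot hd₁ (by rw [← inner_single_two_one]; exact hd₁0)
  obtain ⟨i₂, j₂, hij₂⟩ := exists_coords_of_inplane_slot hd₂ (by rw [← inner_single_two_one]; exact hd₂0)
  -- 3 G a = √6 e₃ + d₁ + d₂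
  have h3a : (3 : ℝ) • G a = Real.sqrt 6 • e₃ + G (a - b) + G (a - c) := by
    rw [map_sub, map_sub, ← hsum]; module
  -- |d₁ + d₂|² = 3 ⇒ I² + IJ + J² = 3
  set I : ℤ := i₁ + i₂ with hI
  set J : ℤ := j₁ + j₂ with hJ
  have hd12 : G (a - b) + G (a - c) = barlowPos 1 (Real.sqrt (2 / 3)) constHagg 0 I J := by
    rw [hij₁, hij₂, barlowPos_fcc_linear 1 _ 0 i₁ j₁, barlowPos_fcc_linear 1 _ 0 i₂ j₂, barlowPos_fcc_linear 1 _ 0 I J, hI, hJ]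
    push_cast; module
  have hinner12 : ⟪G (a - b), G (a - c)⟫_ℝ = 1 / 2 := by
    rw [LinearIsometryEquiv.inner_map_map, inner_sub_left, inner_sub_right, inner_sub_right,
      real_inner_self_eq_norm_sq, norm_eq_one_of_mem_fccSlots ha, real_inner_comm a b, iab, iac, ibc]
    norm_num
  have hIJ : I ^ 2 + I * J + J ^ 2 = 3 := by
    have h1 : ‖G (a - b) + G (a - c)‖ ^ 2 = 3 := by
      rw [norm_add_sq_real, norm_eq_one_of_mem_fccSlots hd₁, norm_eq_one_of_mem_fccSlots hd₂, hinner12]; norm_num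
    rw [hd12, norm_sq_barlowPos_fcc 0 I J] at h1
    have h1' : ((I ^ 2 + I * J + J ^ 2 : ℤ) : ℝ) = 3 := by push_cast at h1 ⊢; linarith
    exact_mod_cast h1'
  obtain ⟨m, n, r, hr, hIm, hJn⟩ := normForm_eq_three hIJ
  -- coordinates of G a
  have h3a' : (3 : ℝ) • G a = Real.sqrt 6 • e₃ + barlowPos 1 (Real.sqrt (2 / 3)) constHagg 0 I J := by
    rw [h3a, add_assoc, hd12]
  obtain ⟨c0, c1, c2⟩ := coords_sqrt6_e₃_add_barlowPos I J
  have hGa0 : (G a) 0 = ((I : ℝ) + J / 2) / 3 := by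
    have h := congrArg (fun v : EuclideanSpace ℝ (Fin 3) => v 0) h3a'
    simp only [PiLp.smul_apply, smul_eq_mul] at h
    rw [he₃] at h; rw [c0] at h; linarith
  have hGa1 : (G a) 1 = Real.sqrt 3 / 2 * J / 3 := by
    have h := congrArg (fun v : EuclideanSpace ℝ (Fin 3) => v 1) h3a'
    simp only [PiLp.smul_apply, smul_eq_mul] at h
    rw [he₃] at h; rw [c1] at h; linarith
  have hGa2 : (G a) 2 = Real.sqrt (2 / 3) := by rw [← inner_single_two_one]; exact hna
  obtain ⟨e0, e1, e2⟩ := e₃_apply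
  -- R fixes in-plane vectors and flips the height
  have hRapp : ∀ x : EuclideanSpace ℝ (Fin 3), R x = x - (2 * x 2) • e₃ := fun x => by
    rw [hR, reflection_unit_apply hn, inner_single_two_one]
  have hRfix : ∀ x : EuclideanSpace ℝ (Fin 3), x 2 = 0 → R x = x := fun x hx => by rw [hRapp, hx]; simp
  -- CASE ANALYSIS on r: G a on layer +1, or R (G a) on layer −1
  have hcase : G a ∈ fccStacking 1 (Real.sqrt (2 / 3)) ∨ R (G a) ∈ fccStacking 1 (Real.sqrt (2 / 3)) := by
    rcases hr with rfl | rfl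
    · left
      have e : G a = barlowPos 1 (Real.sqrt (2 / 3)) constHagg 1 m n := by
        ext l; fin_cases l
        · simp only [Fin.zero_eta, Fin.isValue, barlowPos_apply_zero, haggLabel_const]
          rw [hGa0, hIm, hJn]; push_cast; ring
        · simp only [Fin.mk_one, Fin.isValue, barlowPos_apply_one, haggLabel_const]
          rw [hGa1, hJn]; push_cast; ring
        · simp only [Fin.reduceFinMk, Fin.isValue, barlowPos_apply_two]
          rw [hGa2]; push_cast; ring
      rw [e]; exact barlowPos_mem _ _ _
    · right
      have e : R (G a) = barlowPos 1 (Real.sqrt (2 / 3)) constHagg (-1) (m + 1) (n + 1) := by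
        rw [hRapp, he₃]
        ext l; fin_cases l
        · simp only [Fin.zero_eta, Fin.isValue, PiLp.sub_apply, PiLp.smul_apply, smul_eq_mul, barlowPos_apply_zero,
            haggLabel_const]
          rw [e0, hGa0, hIm, hJn]; push_cast; ring
        · simp only [Fin.mk_one, Fin.isValue, PiLp.sub_apply, PiLp.smul_apply, smul_eq_mul, barlowPos_apply_one,
            haggLabel_const]
          rw [e1, hGa1, hJn]; push_cast; ring
        · simp only [Fin.reduceFinMk, Fin.isValue, PiLp.sub_apply, PiLp.smul_apply, smul_eq_mul, barlowPos_apply_two]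
          rw [e2, hGa2]; push_cast; ring
      rw [e]; exact barlowPos_mem _ _ _
  -- from the far slot `a` to the whole dozen
  have hGb : G b = G a - G (a - b) := by rw [map_sub]; abel
  have hGc : G c = G a - G (a - c) := by rw [map_sub]; abel
  have hd₁Λ := mem_fcc_of_mem_fccSlots hd₁
  have hd₂Λ := mem_fcc_of_mem_fccSlots hd₂
  -- classification of slots by sign
  have hsign : ∀ w ∈ fccSlots, (w = a ∨ w = b ∨ w = c) ∨ (-w = a ∨ -w = b ∨ -w = c) ∨ ⟪G w, e₃⟫_ℝ = 0 := by
    intro w hw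
    rcases hmenu w hw with h0 | hp | hm
    · exact Or.inr (Or.inr h0)
    · exact Or.inl (huniq w hw (by rw [hp]; exact hrpos))
    · refine Or.inr (Or.inl (huniq (-w) (neg_mem_fccSlots hw) ?_))
      rw [map_neg, inner_neg_left, hm, neg_neg]; exact hrpos
  rcases hcase with hA | hA
  · -- CLASS 1: every G w is a site of Λ₀, hence a slot
    left
    have hall : ∀ w ∈ fccSlots, G w ∈ fccStacking 1 (Real.sqrt (2 / 3)) := by
      have hGbΛ : G b ∈ fccStacking 1 (Real.sqrt (2 / 3)) := by rw [hGb]; exact fcc_sub_site_mem hA hd₁Λ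
      have hGcΛ : G c ∈ fccStacking 1 (Real.sqrt (2 / 3)) := by rw [hGc]; exact fcc_sub_site_mem hA hd₂Λ
      intro w hw
      rcases hsign w hw with (rfl | rfl | rfl) | hneg | h0
      · exact hA
      · exact hGbΛ
      · exact hGcΛ
      · have hw' : G (-w) ∈ fccStacking 1 (Real.sqrt (2 / 3)) := by
          rcases hneg with h | h | h <;> rw [h] <;> assumption
        have := fcc_neg_mem hw'
        rwa [map_neg, neg_neg] at this
      · exact mem_fcc_of_mem_fccSlots (hin w hw h0)
    have hsub : fccSlots.image (fun w => G w) ⊆ fccSlots := by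
      intro x hx
      obtain ⟨w, hw, rfl⟩ := mem_image.1 hx
      exact mem_fccSlots_of_unit (hall w hw) (by rw [LinearIsometryEquiv.norm_map, norm_eq_one_of_mem_fccSlots hw])
    refine eq_of_subset_of_card_le hsub ?_
    rw [card_image_of_injective _ G.injective]
  · -- CLASS 2: every R (G w) is a site of Λ₀
    right
    have hRlin : ∀ x y : EuclideanSpace ℝ (Fin 3), R (x - y) = R x - R y := fun x y => map_sub R x y
    have hRneg : ∀ x : EuclideanSpace ℝ (Fin 3), R (-x) = -R x := fun x => map_neg R x
    have hall : ∀ w ∈ fccSlots, R (G w) ∈ fccStacking 1 (Real.sqrt (2 / 3)) := by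
      have hRd₁ : R (G (a - b)) = G (a - b) := hRfix _ (by rw [← inner_single_two_one]; exact hd₁0)
      have hRd₂ : R (G (a - c)) = G (a - c) := hRfix _ (by rw [← inner_single_two_one]; exact hd₂0)
      have hGbΛ : R (G b) ∈ fccStacking 1 (Real.sqrt (2 / 3)) := by
        rw [hGb, hRlin, hRd₁]; exact fcc_sub_site_mem hA hd₁Λ
      have hGcΛ : R (G c) ∈ fccStacking 1 (Real.sqrt (2 / 3)) := by
        rw [hGc, hRlin, hRd₂]; exact fcc_sub_site_mem hA hd₂Λ
      intro w hw
      rcases hsign w hw with (rfl | rfl | rfl) | hneg | h0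
      · exact hA
      · exact hGbΛ
      · exact hGcΛ
      · have hw' : R (G (-w)) ∈ fccStacking 1 (Real.sqrt (2 / 3)) := by
          rcases hneg with h | h | h <;> rw [h] <;> assumption
        have := fcc_neg_mem hw'
        rwa [map_neg, hRneg, neg_neg] at this
      · rw [hRfix _ (by rw [← inner_single_two_one]; exact h0)]
        exact mem_fcc_of_mem_fccSlots (hin w hw h0)
    have hsub : fccSlots.image (fun w => R (G w)) ⊆ fccSlots := by
      intro x hx
      obtain ⟨w, hw, rfl⟩ := mem_image.1 hx
      exact mem_fccSlots_of_unit (hall w hw)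
        (by rw [LinearIsometryEquiv.norm_map, LinearIsometryEquiv.norm_map, norm_eq_one_of_mem_fccSlots hw])
    refine eq_of_subset_of_card_le hsub ?_
    have hinj : Function.Injective (fun w => R (G w)) := fun x y hxy => G.injective (R.injective hxy)
    rw [card_image_of_injective _ hinj]

end Dichotomy

/-- **AXIS RIGIDITY OF TWIN CHAINS (model form).**  A reduced chain `κ` of unit model menu normals whose frame `wordFrame 1 κ` still has `e₃` as a menu normal
is empty or the single basal twin: `κ = []`, `[e₃]` or `[−e₃]`. -/
theorem wordFrame_axis_rigidity (κ : List (EuclideanSpace ℝ (Fin 3)))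
    (hl : ∀ μ ∈ κ, ‖μ‖ = 1 ∧ ∀ w ∈ fccSlots, ⟪w, μ⟫_ℝ = 0 ∨ ⟪w, μ⟫_ℝ = Real.sqrt (2 / 3) ∨ ⟪w, μ⟫_ℝ = -Real.sqrt (2 / 3))
    (hc : List.IsChain (fun μ μ' => ⟪μ, μ'⟫_ℝ = 1 / 3 ∨ ⟪μ, μ'⟫_ℝ = -1 / 3) κ)
    (hmenu : ∀ w ∈ fccSlots,
      ⟪wordFrame (LinearIsometryEquiv.refl ℝ _) κ w, EuclideanSpace.single (2 : Fin 3) (1 : ℝ)⟫_ℝ = 0 ∨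
      ⟪wordFrame (LinearIsometryEquiv.refl ℝ _) κ w, EuclideanSpace.single (2 : Fin 3) (1 : ℝ)⟫_ℝ = Real.sqrt (2 / 3) ∨
      ⟪wordFrame (LinearIsometryEquiv.refl ℝ _) κ w, EuclideanSpace.single (2 : Fin 3) (1 : ℝ)⟫_ℝ = -Real.sqrt (2 / 3)) :
    κ = [] ∨ κ = [EuclideanSpace.single (2 : Fin 3) (1 : ℝ)] ∨ κ = [-EuclideanSpace.single (2 : Fin 3) (1 : ℝ)] := by
  classical
  set e₃ : EuclideanSpace ℝ (Fin 3) := EuclideanSpace.single (2 : Fin 3) (1 : ℝ) with he₃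
  set G := wordFrame (LinearIsometryEquiv.refl ℝ (EuclideanSpace ℝ (Fin 3))) κ with hG
  have hn : ‖e₃‖ = 1 := by rw [he₃, PiLp.norm_single, norm_one]
  have hin : ∀ w ∈ fccSlots, ⟪G w, e₃⟫_ℝ = 0 → G w ∈ fccSlots := fun w hw h0 =>
    wordFrame_inplane_mem_fccSlots κ hl hw (by rw [← inner_single_two_one]; exact h0)
  -- e₃ is a unit model menu normal: the hypotheses `hl'` for the words `[]`, `[e₃]`
  have he₃menu : ∀ w ∈ fccSlots, ⟪w, e₃⟫_ℝ = 0 ∨ ⟪w, e₃⟫_ℝ = Real.sqrt (2 / 3) ∨ ⟪w, e₃⟫_ℝ = -Real.sqrt (2 / 3) := by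
    intro w hw; rw [inner_single_two_one]; exact slot_apply_two_cases hw
  rcases image_fccSlots_eq_or_mirror_of_axis hmenu hin with h | h
  · -- same dozen as Λ₀ ⇒ κ = []
    left
    have himg : (G : EuclideanSpace ℝ (Fin 3) → EuclideanSpace ℝ (Fin 3)) '' ↑fccSlots =
        (wordFrame (LinearIsometryEquiv.refl ℝ (EuclideanSpace ℝ (Fin 3))) [] : _ → _) '' ↑fccSlots := by
      rw [← coe_image, h]; simp [wordFrame]
    have hmap := map_reflection_eq_of_image_eq (LinearIsometryEquiv.refl ℝ _) hl hc
      (κ' := []) (fun _ h => by simp at h) List.isChain_nil himg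
    simpa using hmap
  · -- mirrored dozen ⇒ κ = [±e₃]
    right
    set R := (ℝ ∙ e₃)ᗮ.reflection with hR
    have hRR : ∀ x, R (R x) = x := fun x => by rw [hR]; exact Submodule.reflection_reflection _ x
    have himgF : fccSlots.image (fun w => G w) = fccSlots.image (fun w => R w) := by
      have := congrArg (fun S : Finset (EuclideanSpace ℝ (Fin 3)) => S.image (fun w => R w)) h
      simp only [image_image] at this
      rw [← this]
      exact image_congr fun w _ => by simp [Function.comp, hRR]
    have himg : (G : EuclideanSpace ℝ (Fin 3) → EuclideanSpace ℝ (Fin 3)) '' ↑fccSlots =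
        (wordFrame (LinearIsometryEquiv.refl ℝ (EuclideanSpace ℝ (Fin 3))) [e₃] : _ → _) '' ↑fccSlots := by
      rw [← coe_image, himgF, coe_image]
      rfl
    have hmap := map_reflection_eq_of_image_eq (LinearIsometryEquiv.refl ℝ _) hl hc
      (κ' := [e₃]) (fun μ hμ => by rw [List.mem_singleton] at hμ; rw [hμ]; exact ⟨hn, he₃menu⟩)
      (List.isChain_singleton _) himg
    -- κ.map refl = [refl e₃] ⇒ κ = [μ] with refl μ = refl e₃
    obtain ⟨μ, rfl, hμ⟩ : ∃ μ, κ = [μ] ∧ (ℝ ∙ μ)ᗮ.reflection = (ℝ ∙ e₃)ᗮ.reflection := by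
      rcases κ with _ | ⟨μ, _ | ⟨μ', κ''⟩⟩
      · simp at hmap
      · simp only [List.map_cons, List.map_nil, List.cons.injEq, and_true] at hmap
        exact ⟨μ, rfl, hmap⟩
      · simp at hmap
    rcases eq_or_eq_neg_of_reflection_eq (hl μ (by simp)).1 hn hμ with h1 | h1
    · left; rw [h1]
    · right; rw [h1]

/-- **AXIS RIGIDITY over a base frame `B`**: if `B e₃` is a menu normal of `wordFrame B κ` for a reduced chain `κ` of unit model menu normals, then
`κ = []`, `[e₃]` or `[−e₃]` — the chain lattice is `B·Λ₀` or its basal twin about `B e₃`. -/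
theorem wordFrame_axis_rigidity_base (B : EuclideanSpace ℝ (Fin 3) ≃ₗᵢ[ℝ] EuclideanSpace ℝ (Fin 3))
    (κ : List (EuclideanSpace ℝ (Fin 3)))
    (hl : ∀ μ ∈ κ, ‖μ‖ = 1 ∧ ∀ w ∈ fccSlots, ⟪w, μ⟫_ℝ = 0 ∨ ⟪w, μ⟫_ℝ = Real.sqrt (2 / 3) ∨ ⟪w, μ⟫_ℝ = -Real.sqrt (2 / 3))
    (hc : List.IsChain (fun μ μ' => ⟪μ, μ'⟫_ℝ = 1 / 3 ∨ ⟪μ, μ'⟫_ℝ = -1 / 3) κ)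
    (hmenu : ∀ w ∈ fccSlots,
      ⟪wordFrame B κ w, B (EuclideanSpace.single (2 : Fin 3) (1 : ℝ))⟫_ℝ = 0 ∨
      ⟪wordFrame B κ w, B (EuclideanSpace.single (2 : Fin 3) (1 : ℝ))⟫_ℝ = Real.sqrt (2 / 3) ∨
      ⟪wordFrame B κ w, B (EuclideanSpace.single (2 : Fin 3) (1 : ℝ))⟫_ℝ = -Real.sqrt (2 / 3)) :
    κ = [] ∨ κ = [EuclideanSpace.single (2 : Fin 3) (1 : ℝ)] ∨ κ = [-EuclideanSpace.single (2 : Fin 3) (1 : ℝ)] := by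
  refine wordFrame_axis_rigidity κ hl hc fun w hw => ?_
  have h := hmenu w hw
  rwa [wordFrame_apply_eq, LinearIsometryEquiv.inner_map_map] at h

end Summit.Ventures.Crystal3D.Theorems

end
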